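import Summits.CriticalPhenomena.Ising3D.TaylorCertificateOddOfLt
import Summits.CriticalPhenomena.Ising3D.OddTailEulerWeights
import Mathlib.Tactic.Linarith
import Mathlib.Tactic.Positivity
import Mathlib.Tactic.Ring
import HarnessLib

/-!
# The odd-sector CONE rule of a derivative-functional certificate (gate (g1) of M3-γ, HasSum layer)
(cell `pub-ising3x`, seat recog-1 gen 10; the typed form of obligation (D5b) of
HOME/pub-ising3x-boot-1/OBLIGATIONS-pmp1-deriv-rc0-DRAFT.md, replacing the dominated odd tail (D5a)
`tail_odd_of_dominated`, which is unsatisfiable far down every block)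

HONEST FRAMING: lottery ticket; floor = tightest certified 3D Ising CFT bounds; no exact-solution
claim without a proof.

Setting: `α⃗` Taylor at a diagonal point `(x,x)`, an odd-sector block `(Δ, ℓ)` strictly above the
unitarity bound (`Δ ≠ 1` if `ℓ = 0`), `t = Δσ - Δε`, the three coefficient families `A⁺ = A(t/2,t/2) ≥ 0`
(`gpm`), `A⁻ = A(-t/2,-t/2) ≥ 0` (the Dolan–Osborn conjugate `v^t gpm`) and the signed `Aˢ = A(-t/2,t/2)`
(`gmm`, sum rule 3). The odd form is `Σ_q oddTermValue q` (`hasSum_oddForm_of_isTaylorAt_of_lt`) and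
`|Aˢ| ≤ ½(κ₀ A⁺ + κ₀⁻¹ A⁻)` for every `κ₀ > 0` (`abs_hrCoeffAB_neg_le_weighted`), so the obstruction to a
termwise certificate is the `A⁻`-weighted series of `|α³[F^{s̄}_-𝒫_q]|`.
* CONVERSION (`IsTaylorFunctional.hasSum_conjBlock_neg / _self`): for ANY Taylor functional `Ψ` at
  `(x,x)`, `Σ_q (A⁻_q/λ_ℓ) Ψ(𝒫_{Δ+n,j}) = Ψ(v^t gpm) = Σ_q (A⁺_q/λ_ℓ) Ψ(crossF t 0 𝒫_{Δ+n,j})` — termwise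
  evaluation of `Ψ` on the conjugate block, once as a `(t,-t)` block with the trivial wrapper
  `crossF 0 0 = id`, once as `crossF t 0 gpm = v^t gpm`. No Euler weights or Leibniz rule are needed at
  this level (HOME/pub-ising3x-recog-1/gen9/G1-REDUCTION.md Lemma B is the special case `Ψ = Ev_{m,k}`).
* MAJORANT `Ψ` (certificate data) with (M) `|α³[F^{s̄}_-𝒫_{E,j}]| ≤ Ψ(𝒫_{E,j})` and the CONE inequality
  (R) `α⁴[F^{Δσ}_-𝒫] - α⁵[F^{Δσ}_+𝒫] ≥ ½κ₀|α³[F^{s̄}_-𝒫]| + ½κ₀⁻¹ Ψ(crossF t 0 𝒫)` at the tail terms,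
  together `OddConeAt`; and the corrected HEAD value `oddConeHeadValue q = oddTermValue q +
  ½κ₀⁻¹((A⁻_q/λ)Ψ(𝒫_q) - (A⁺_q/λ)Ψ(crossF t 0 𝒫_q))`, whose series ALSO sums to the odd form.
* THEOREM `oddPositive_of_isTaylorAt_of_cone_of_lt`: head `0 ≤ Σ_{q∈F} oddConeHeadValue q` and
  `OddConeAt` off `F` (descendant range) give `OddPositive` — every `Δ` strictly above the bound,
  accidental degeneracies included (the `OfLt` z-series).
All values are closed forms already in the tree at `x = ½` (`taylorCoeffAt_crossF_zMono_half` with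
`σ = 0` for `Ψ(crossF t 0 𝒫)`: the conversion constants `v_{p,i}` of G1-REDUCTION §3). Measured cost of
these constraints at Λ = 11 (float, design basis): ≤ 12 % objective price, 0 verdict flips
(HOME/pub-ising3x-recog-1/gen9/M-G1-RESULT.md v3.2; boot-1 MG1-LOG.md). Sources: Dolan–Osborn 2004 §3
eq. (3.11) (conjugation / coefficient families, as typed in `BlockZSeriesAB(OfLt)`,
`BlockConjugationSymmetry`); Kos–Poland–Simmons-Duffin 2014 §3.3 eq. (3.16).
-/

namespace Summit.CriticalPhenomena.Ising3D

open Finset Set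
open Literature.MathematicalPhysics.QuantumFieldTheory.ConformalBootstrap3D

/-! ### The conversion identity -/

/-- With sign `0` the crossing wrapper is the conjugation prefactor: `crossF s 0 g = v^s g`.
[folklore] -/
theorem crossF_zero_right (s : ℝ) (g : ℝ → ℝ → ℝ) : crossF s 0 g = conjBlock s g := by
  funext z zb
  simp only [crossF, conjBlock, zero_mul, add_zero]

/-- **Conversion, conjugate side.** For a Taylor functional `Ψ` at `(x,x)` and `gpm = g^{-t,t}_{Δ,ℓ}`
strictly above the bound, the `A(-t/2,-t/2)`-weighted series of `Ψ` on the bare Legendre monomials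
sums to `Ψ(v^t gpm)` (the conjugate is a genuine `(t,-t)` block). [cite: DolanOsborn2004, §3 eq. (3.11)] -/
theorem IsTaylorFunctional.hasSum_conjBlock_neg {x : ℝ} (hx0 : 0 < x) (hx1 : x < 1)
    {Ψ : (ℝ → ℝ → ℝ) →ₗ[ℝ] ℝ} (hΨ : IsTaylorFunctional x x Ψ) {t Δ : ℝ} {ℓ : ℕ}
    {gpm : ℝ → ℝ → ℝ} (hΔ : unitarityBound3D ℓ < Δ) (hpm : IsConformalBlock3D (-t) t Δ ℓ gpm) :
    HasSum (fun q : ℕ × ℕ => hrCoeffAB (-t / 2) (-t / 2) Δ ℓ q.1 q.2 / legendreLam ℓ *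
        Ψ (zMono (Δ + (q.1 : ℝ)) q.2)) (Ψ (conjBlock t gpm)) := by
  have hconj : IsConformalBlock3D t (-t) Δ ℓ (conjBlock t gpm) := by
    have h := hpm.conj
    have he : (t - -t) / 2 = t := by ring
    rw [neg_neg, he] at h
    exact h
  have h := hΨ.hasSum_crossF_hrZTermAB_self_of_lt hx0 hx1 0 0 hΔ (by ring) hconj
  simpa only [crossF_zero_zero] using h

/-- **Conversion, `gpm` side.** The same value `Ψ(v^t gpm)` is the `A(t/2,t/2)`-weighted series of `Ψ`
on the conjugated monomials `crossF t 0 𝒫_{Δ+n,j} = v^t 𝒫_{Δ+n,j}`. [cite: DolanOsborn2004, §3 eq. (3.11)] -/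
theorem IsTaylorFunctional.hasSum_conjBlock_self {x : ℝ} (hx0 : 0 < x) (hx1 : x < 1)
    {Ψ : (ℝ → ℝ → ℝ) →ₗ[ℝ] ℝ} (hΨ : IsTaylorFunctional x x Ψ) {t Δ : ℝ} {ℓ : ℕ}
    {gpm : ℝ → ℝ → ℝ} (hΔ : unitarityBound3D ℓ < Δ) (hpm : IsConformalBlock3D (-t) t Δ ℓ gpm) :
    HasSum (fun q : ℕ × ℕ => hrCoeffAB (t / 2) (t / 2) Δ ℓ q.1 q.2 / legendreLam ℓ *
        Ψ (crossF t 0 (zMono (Δ + (q.1 : ℝ)) q.2))) (Ψ (conjBlock t gpm)) := by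
  have h := hΨ.hasSum_crossF_hrZTermAB_self_of_lt hx0 hx1 t 0 hΔ (by ring) hpm
  rwa [crossF_zero_right t gpm] at h

/-- **Conversion identity** (both series have the same sum). [cite: DolanOsborn2004, §3 eq. (3.11)] -/
theorem IsTaylorFunctional.tsum_conj_eq_tsum_self {x : ℝ} (hx0 : 0 < x) (hx1 : x < 1)
    {Ψ : (ℝ → ℝ → ℝ) →ₗ[ℝ] ℝ} (hΨ : IsTaylorFunctional x x Ψ) {t Δ : ℝ} {ℓ : ℕ}
    {gpm : ℝ → ℝ → ℝ} (hΔ : unitarityBound3D ℓ < Δ) (hpm : IsConformalBlock3D (-t) t Δ ℓ gpm) :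
    ∑' q : ℕ × ℕ, hrCoeffAB (-t / 2) (-t / 2) Δ ℓ q.1 q.2 / legendreLam ℓ *
        Ψ (zMono (Δ + (q.1 : ℝ)) q.2) =
      ∑' q : ℕ × ℕ, hrCoeffAB (t / 2) (t / 2) Δ ℓ q.1 q.2 / legendreLam ℓ *
        Ψ (crossF t 0 (zMono (Δ + (q.1 : ℝ)) q.2)) := by
  rw [(hΨ.hasSum_conjBlock_neg hx0 hx1 hΔ hpm).tsum_eq, (hΨ.hasSum_conjBlock_self hx0 hx1 hΔ hpm).tsum_eq]

/-! ### The cone obligations at a monomial and the corrected head value -/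

/-- **The odd CONE condition at the monomial `𝒫_{E,j}`** for external dimensions `(Δσ, Δε)`, a
majorant functional `Ψ` and a weight `κ₀`: (M) `|α³[F^{s̄}_-𝒫]| ≤ Ψ(𝒫)` and (R)
`½κ₀|α³[F^{s̄}_-𝒫]| + ½κ₀⁻¹ Ψ(crossF (Δσ-Δε) 0 𝒫) ≤ α⁴[F^{Δσ}_-𝒫] - α⁵[F^{Δσ}_+𝒫]`, `s̄ = (Δσ+Δε)/2`.
[cite: KosPolandSimmonsduffin2014, §3.3 eq. (3.16)] -/
def OddConeAt (α : CrossingFunctional) (Ψ : (ℝ → ℝ → ℝ) →ₗ[ℝ] ℝ) (κ₀ Δσ Δε E : ℝ) (j : ℕ) : Prop :=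
  |α.α₃ (crossF ((Δσ + Δε) / 2) (-1) (zMono E j))| ≤ Ψ (zMono E j) ∧
    κ₀ / 2 * |α.α₃ (crossF ((Δσ + Δε) / 2) (-1) (zMono E j))| +
        κ₀⁻¹ / 2 * Ψ (crossF (Δσ - Δε) 0 (zMono E j)) ≤
      α.α₄ (crossF Δσ (-1) (zMono E j)) - α.α₅ (crossF Δσ 1 (zMono E j))

/-- **The corrected odd HEAD value at `(n,j)`**: the term value plus the conversion correction
`½κ₀⁻¹((A⁻_{n,j}/λ_ℓ) Ψ(𝒫_{Δ+n,j}) - (A⁺_{n,j}/λ_ℓ) Ψ(crossF (Δσ-Δε) 0 𝒫_{Δ+n,j}))`.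
[cite: KosPolandSimmonsduffin2014, §3.3 eq. (3.16)] -/
noncomputable def oddConeHeadValue (α : CrossingFunctional) (Ψ : (ℝ → ℝ → ℝ) →ₗ[ℝ] ℝ)
    (κ₀ Δσ Δε Δ : ℝ) (ℓ : ℕ) (q : ℕ × ℕ) : ℝ :=
  oddTermValue α Δσ Δε Δ ℓ q +
    κ₀⁻¹ / 2 * (hrCoeffAB (-(Δσ - Δε) / 2) (-(Δσ - Δε) / 2) Δ ℓ q.1 q.2 / legendreLam ℓ *
        Ψ (zMono (Δ + (q.1 : ℝ)) q.2) -
      hrCoeffAB ((Δσ - Δε) / 2) ((Δσ - Δε) / 2) Δ ℓ q.1 q.2 / legendreLam ℓ *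
        Ψ (crossF (Δσ - Δε) 0 (zMono (Δ + (q.1 : ℝ)) q.2)))

/-- **The corrected head values ALSO sum to the odd form** (the two conversion series cancel).
[cite: DolanOsborn2004, §3 eq. (3.11)] -/
theorem hasSum_oddConeHeadValue_of_lt {x : ℝ} (hx0 : 0 < x) (hx1 : x < 1) (α : CrossingFunctional)
    (hα : IsTaylorAt α x x) {Ψ : (ℝ → ℝ → ℝ) →ₗ[ℝ] ℝ} (hΨ : IsTaylorFunctional x x Ψ) (κ₀ : ℝ)
    {Δσ Δε Δ : ℝ} {ℓ : ℕ} {g₁ g₂ : ℝ → ℝ → ℝ} (hΔ : unitarityBound3D ℓ < Δ) (h1 : ℓ = 0 → Δ ≠ 1)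
    (hg₁ : IsConformalBlock3D (Δσ - Δε) (Δσ - Δε) Δ ℓ g₁)
    (hg₂ : IsConformalBlock3D (-(Δσ - Δε)) (Δσ - Δε) Δ ℓ g₂) :
    HasSum (oddConeHeadValue α Ψ κ₀ Δσ Δε Δ ℓ) (α.oddForm Δσ Δε ℓ g₁ g₂) := by
  have hS := hasSum_oddForm_of_isTaylorAt_of_lt hx0 hx1 α hα hΔ h1 hg₁ hg₂
  have hM := hΨ.hasSum_conjBlock_neg hx0 hx1 hΔ hg₂
  have hP := hΨ.hasSum_conjBlock_self hx0 hx1 hΔ hg₂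
  have h := hS.add ((hM.sub hP).mul_left (κ₀⁻¹ / 2))
  rw [sub_self, mul_zero, add_zero] at h
  refine h.congr_fun fun q => ?_
  simp only [oddConeHeadValue]

/-- Outside the descendant range the corrected head value vanishes. [folklore] -/
theorem oddConeHeadValue_eq_zero_of_not_inDescendantRange (α : CrossingFunctional)
    (Ψ : (ℝ → ℝ → ℝ) →ₗ[ℝ] ℝ) (κ₀ Δσ Δε Δ : ℝ) {ℓ : ℕ} {q : ℕ × ℕ}
    (hq : ¬ InDescendantRange ℓ q.1 q.2) : oddConeHeadValue α Ψ κ₀ Δσ Δε Δ ℓ q = 0 := by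
  unfold oddConeHeadValue oddTermValue
  rw [hrCoeffAB_eq_zero_of_not_inDescendantRange _ _ Δ hq,
    hrCoeffAB_eq_zero_of_not_inDescendantRange _ _ Δ hq,
    hrCoeffAB_eq_zero_of_not_inDescendantRange _ _ Δ hq]
  ring

/-- **Termwise: the cone condition makes the corrected head value non-negative** (strictly above the
bound, `Δ ≠ 1` if `ℓ = 0`, `κ₀ > 0`): `oddConeHeadValue q ≥ (A⁺/λ)[φ₄₅ - ½κ₀|φ₃| - ½κ₀⁻¹Ψ(v^t𝒫)]
+ ½κ₀⁻¹(A⁻/λ)[Ψ(𝒫) - |φ₃|] ≥ 0`. [cite: DolanOsborn2004, §3 eq. (3.11)] -/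
theorem oddConeHeadValue_nonneg_of_oddConeAt (α : CrossingFunctional) (Ψ : (ℝ → ℝ → ℝ) →ₗ[ℝ] ℝ)
    {κ₀ : ℝ} (hκ₀ : 0 < κ₀) (Δσ Δε : ℝ) {Δ : ℝ} {ℓ : ℕ} (hΔ : unitarityBound3D ℓ < Δ)
    (h1 : ℓ = 0 → Δ ≠ 1) (q : ℕ × ℕ) (hq : OddConeAt α Ψ κ₀ Δσ Δε (Δ + (q.1 : ℝ)) q.2) :
    0 ≤ oddConeHeadValue α Ψ κ₀ Δσ Δε Δ ℓ q := by
  obtain ⟨hMq, hRq⟩ := hq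
  unfold oddConeHeadValue oddTermValue
  set cS := hrCoeffAB (-(Δσ - Δε) / 2) ((Δσ - Δε) / 2) Δ ℓ q.1 q.2 / legendreLam ℓ with hcS
  set cP := hrCoeffAB ((Δσ - Δε) / 2) ((Δσ - Δε) / 2) Δ ℓ q.1 q.2 / legendreLam ℓ with hcP
  set cM := hrCoeffAB (-(Δσ - Δε) / 2) (-(Δσ - Δε) / 2) Δ ℓ q.1 q.2 / legendreLam ℓ with hcM
  set φ₃ := α.α₃ (crossF ((Δσ + Δε) / 2) (-1) (zMono (Δ + (q.1 : ℝ)) q.2)) with hφ₃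
  set φ₄₅ := α.α₄ (crossF Δσ (-1) (zMono (Δ + (q.1 : ℝ)) q.2)) -
    α.α₅ (crossF Δσ 1 (zMono (Δ + (q.1 : ℝ)) q.2)) with hφ₄₅
  set ψP := Ψ (zMono (Δ + (q.1 : ℝ)) q.2) with hψP
  set ψV := Ψ (crossF (Δσ - Δε) 0 (zMono (Δ + (q.1 : ℝ)) q.2)) with hψV
  have hlam := legendreLam_pos ℓ
  have hP0 : 0 ≤ cP := div_nonneg (hrCoeffAB_self_nonneg _ hΔ _ _) hlam.le
  have hM0 : 0 ≤ cM := div_nonneg (hrCoeffAB_self_nonneg _ hΔ _ _) hlam.le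
  have hκ' : 0 < κ₀⁻¹ := inv_pos.mpr hκ₀
  -- weighted AM–GM on the coefficients, divided by λ_ℓ
  have hAM : |cS| ≤ (κ₀ * cP + κ₀⁻¹ * cM) / 2 := by
    have hb := abs_hrCoeffAB_neg_le_weighted (a := -(Δσ - Δε) / 2) hΔ h1 hκ' q.1 q.2
    rw [inv_inv, show -(-(Δσ - Δε) / 2) = (Δσ - Δε) / 2 by ring] at hb
    rw [hcS, hcP, hcM, abs_div, abs_of_pos hlam, div_le_iff₀ hlam]
    have : (κ₀ * (hrCoeffAB ((Δσ - Δε) / 2) ((Δσ - Δε) / 2) Δ ℓ q.1 q.2 / legendreLam ℓ) +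
          κ₀⁻¹ * (hrCoeffAB (-(Δσ - Δε) / 2) (-(Δσ - Δε) / 2) Δ ℓ q.1 q.2 / legendreLam ℓ)) / 2 *
        legendreLam ℓ =
        (κ₀⁻¹ * hrCoeffAB (-(Δσ - Δε) / 2) (-(Δσ - Δε) / 2) Δ ℓ q.1 q.2 +
          κ₀ * hrCoeffAB ((Δσ - Δε) / 2) ((Δσ - Δε) / 2) Δ ℓ q.1 q.2) / 2 := by
      field_simp
      ring
    rw [this]
    exact hb
  -- the signed term is at least `-|cS| |φ₃|`
  have hsgn : -(|cS| * |φ₃|) ≤ (-1 : ℝ) ^ ℓ * cS * φ₃ := by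
    have : |(-1 : ℝ) ^ ℓ * cS * φ₃| = |cS| * |φ₃| := by
      rw [abs_mul, abs_mul, abs_pow, abs_neg, abs_one, one_pow, one_mul]
    have := neg_abs_le ((-1 : ℝ) ^ ℓ * cS * φ₃)
    linarith
  have hφ : 0 ≤ |φ₃| := abs_nonneg _
  -- |cS| |φ₃| ≤ ½(κ₀ cP + κ₀⁻¹ cM) |φ₃|
  have h2 : |cS| * |φ₃| ≤ (κ₀ * cP + κ₀⁻¹ * cM) / 2 * |φ₃| := mul_le_mul_of_nonneg_right hAM hφ
  -- the two bracket inequalities, weighted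
  have h3 : cP * (κ₀ / 2 * |φ₃| + κ₀⁻¹ / 2 * ψV) ≤ cP * φ₄₅ := mul_le_mul_of_nonneg_left hRq hP0
  have h4 : κ₀⁻¹ / 2 * cM * |φ₃| ≤ κ₀⁻¹ / 2 * cM * ψP :=
    mul_le_mul_of_nonneg_left hMq (by positivity)
  nlinarith [hsgn, h2, h3, h4]

/-! ### The block rule -/

/-- **Odd-sector positivity from the cone condition, every `Δ` strictly above the bound** (accidental
degeneracies included; `Δ ≠ 1` if `ℓ = 0`). For `α⃗` Taylor at `(x,x)`, a Taylor functional `Ψ` at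
`(x,x)`, `κ₀ > 0` and a finite head set `F`: if `0 ≤ Σ_{q∈F} oddConeHeadValue q` and `OddConeAt` holds
at every descendant term off `F`, then `OddPositive α Δσ Δε Δ ℓ`.
[cite: KosPolandSimmonsduffin2014, §3.3 eq. (3.16)] -/
theorem oddPositive_of_isTaylorAt_of_cone_of_lt {x : ℝ} (hx0 : 0 < x) (hx1 : x < 1)
    (α : CrossingFunctional) (hα : IsTaylorAt α x x) {Ψ : (ℝ → ℝ → ℝ) →ₗ[ℝ] ℝ}
    (hΨ : IsTaylorFunctional x x Ψ) {κ₀ : ℝ} (hκ₀ : 0 < κ₀) {Δσ Δε Δ : ℝ} {ℓ : ℕ}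
    (hΔ : unitarityBound3D ℓ < Δ) (h1 : ℓ = 0 → Δ ≠ 1) (F : Finset (ℕ × ℕ))
    (hhead : 0 ≤ ∑ q ∈ F, oddConeHeadValue α Ψ κ₀ Δσ Δε Δ ℓ q)
    (htail : ∀ q : ℕ × ℕ, q ∉ F → InDescendantRange ℓ q.1 q.2 →
      OddConeAt α Ψ κ₀ Δσ Δε (Δ + (q.1 : ℝ)) q.2) :
    α.OddPositive Δσ Δε Δ ℓ := by
  intro g₁ g₂ hg₁ hg₂
  have hL := hasSum_oddConeHeadValue_of_lt hx0 hx1 α hα hΨ κ₀ hΔ h1 hg₁ hg₂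
  refine hhead.trans (sum_le_hasSum F (fun q hq => ?_) hL)
  by_cases hr : InDescendantRange ℓ q.1 q.2
  · exact oddConeHeadValue_nonneg_of_oddConeAt α Ψ hκ₀ Δσ Δε hΔ h1 q (htail q hq hr)
  · rw [oddConeHeadValue_eq_zero_of_not_inDescendantRange α Ψ κ₀ Δσ Δε Δ hr]

/-- **Corollary (TAIL blocks, `F = ∅`).** If `OddConeAt` holds at every descendant term of the block,
`OddPositive` holds. [cite: KosPolandSimmonsduffin2014, §3.3 eq. (3.16)] -/
theorem oddPositive_of_isTaylorAt_of_cone_tail {x : ℝ} (hx0 : 0 < x) (hx1 : x < 1)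
    (α : CrossingFunctional) (hα : IsTaylorAt α x x) {Ψ : (ℝ → ℝ → ℝ) →ₗ[ℝ] ℝ}
    (hΨ : IsTaylorFunctional x x Ψ) {κ₀ : ℝ} (hκ₀ : 0 < κ₀) {Δσ Δε Δ : ℝ} {ℓ : ℕ}
    (hΔ : unitarityBound3D ℓ < Δ) (h1 : ℓ = 0 → Δ ≠ 1)
    (hcone : ∀ q : ℕ × ℕ, InDescendantRange ℓ q.1 q.2 → OddConeAt α Ψ κ₀ Δσ Δε (Δ + (q.1 : ℝ)) q.2) :
    α.OddPositive Δσ Δε Δ ℓ :=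
  oddPositive_of_isTaylorAt_of_cone_of_lt hx0 hx1 α hα hΨ hκ₀ hΔ h1 ∅ (by simp)
    fun q _ hr => hcone q hr

end Summit.CriticalPhenomena.Ising3D
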